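import Mathlib
import HarnessLib
import Summits.NavierStokesRegularity.NavierStokesRegularity.Theorems.PoloidalWindowDoorPoloidalWindowRigidityConstantShearEnergy

/-!
# Route `PoloidalWindowDoor`, crux `PoloidalWindowRigidity` (K2, stmt-NavierStokesRegularity-19708) —
# the SEPARATED-PRESSURE stratum: the averaged energy identity WITHOUT the wave identity

Cell ns-regularity-ideate, seat ns-poloidal-K2-p2 (stub-worker, gen 2; support lemmas `--supports` the crux,
`--as helper`).  Generalisation of `…ConstantShearEnergy` from constant proportional shear to an ARBITRARY `C²`
divergence-free slice: the vertical second derivative is traded for horizontal ones through `div u = 0` alone,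
`θ∂₂²θ = −θ div_h(∂₂u_h) = −div_h(θ∂₂u_h) + ∇_hθ·∂₂u_h` (`θ = u₂`), so the dissipation of the averaged energy identity
becomes the CLEBSCH PRODUCTION `⟨∇_hθ·(∇_hθ − ∂₂u_h)⟩` (`= ⟨Λ|∇_hψ|²⟩` in Clebsch variables, `= (1−μ)⟨|∇_hθ|²⟩` on the
constant-shear stratum):

* `energy_mean_sep` — `⟨2θθₜ⟩ + ⟨∂₂θ³⟩ + 2⟨∇_hθ·(∇_hθ − ∂₂u_h)⟩ − 2g⟨θ⟩ = O((M₀³ + 4M₀M₁)K/R)` whenever the source `g` of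
  the vertical momentum equation depends on the height only (the separated-pressure stratum `∇_h f₂ ≡ 0`);
* `key_mean_sep` — with (b) of `…ConstantShearMeans`: `V̇ + 2G_z + 2⟨∇_hθ·(∇_hθ − ∂₂u_h)⟩ ≤ (8M₀³ + 8M₀M₁)K/R`.

WHAT THIS IS NOT: not a claim about Navier–Stokes — averaged calculus identities for one located stratum of a door
route's Type-I Liouville problem (bears_on LADDER-NS N0, rung N0-LocalTubeDoorPoloidal).
-/

noncomputable section

-- the summit and its single sub-problem share the name (CONVENTIONS §1), as in every Theorems file
set_option linter.dupNamespace false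

namespace Summit.NavierStokesRegularity.NavierStokesRegularity.Theorems.PoloidalWindowDoorPoloidalWindowRigiditySeparatedShearEnergy

open MeasureTheory Set Function Filter Topology Metric
open scoped RealInnerProductSpace InnerProductSpace ContDiff
open Summit.NavierStokesRegularity.NavierStokesRegularity.Theorems.PoloidalWindowDoorPoloidalWindowRigidityHorizontalMean
open Summit.NavierStokesRegularity.NavierStokesRegularity.Theorems.PoloidalWindowDoorPoloidalWindowRigidityConstantShearMeans
open Summit.NavierStokesRegularity.NavierStokesRegularity.Theorems.PoloidalWindowDoorPoloidalWindowRigidityConstantShearEnergy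

section Slice

variable (φ : ContDiffBump (0 : EuclideanSpace ℝ (Fin 2))) (c : EuclideanSpace ℝ (Fin 3)) {R : ℝ} (z : ℝ)
  {u : EuclideanSpace ℝ (Fin 3) → EuclideanSpace ℝ (Fin 3)} {M₀ M₁ : ℝ}
  {θt : EuclideanSpace ℝ (Fin 3) → ℝ} {g : ℝ → ℝ}

/-! ### (c) without the wave identity: the Clebsch production as dissipation -/

/-- **(c) `⟨2θθₜ⟩ + ⟨∂₂θ³⟩ + 2⟨∇_hθ·(∇_hθ − ∂₂u_h)⟩ − 2g⟨θ⟩ = O((M₀³ + 4M₀M₁)K/R)`.**  Multiply the vertical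
momentum equation by `2θ`: `2θ Dθ(u) = ∂₀(u₀θ²) + ∂₁(u₁θ²) + ∂₂(θ³)` and, by `div u = 0` alone
(`∂₂²θ = −∂₀(∂₂u₀) − ∂₁(∂₂u₁)`), `2θ Σᵢ∂ᵢ∂ᵢθ = 2div_h(θ(∇_hθ − ∂₂u_h)) − 2∇_hθ·(∇_hθ − ∂₂u_h)`; the pressure work
`2gθ` averages to `2g⟨θ⟩` because `g` depends on the height only. -/
theorem energy_mean_sep (hu : ContDiff ℝ 2 u)
    (hdiv : ∀ x, fderiv ℝ u x (EuclideanSpace.single 0 (1 : ℝ)) 0 + fderiv ℝ u x (EuclideanSpace.single 1 (1 : ℝ)) 1 +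
      fderiv ℝ u x (EuclideanSpace.single 2 (1 : ℝ)) 2 = 0)
    (hM₀ : ∀ x, ‖u x‖ ≤ M₀) (hM₁ : ∀ x, ‖fderiv ℝ u x‖ ≤ M₁) (hθt : Continuous θt)
    (heq : ∀ x, θt x + fderiv ℝ (fun y => u y 2) x (u x) -
      ∑ i : Fin 3, fderiv ℝ (fun y => fderiv ℝ (fun y' => u y' 2) y (EuclideanSpace.single i (1 : ℝ))) x
        (EuclideanSpace.single i (1 : ℝ)) = g (x 2))
    (hR : 0 < R) :
    |hmean φ c R z (fun x => 2 * u x 2 * θt x) +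
        hmean φ c R z (fun x => fderiv ℝ (fun y => u y 2 ^ 3) x (EuclideanSpace.single 2 (1 : ℝ))) +
        2 * hmean φ c R z (fun x =>
          fderiv ℝ (fun y => u y 2) x (EuclideanSpace.single 0 (1 : ℝ)) *
            (fderiv ℝ (fun y => u y 2) x (EuclideanSpace.single 0 (1 : ℝ)) - fderiv ℝ u x (EuclideanSpace.single 2 (1 : ℝ)) 0) +
          fderiv ℝ (fun y => u y 2) x (EuclideanSpace.single 1 (1 : ℝ)) *
            (fderiv ℝ (fun y => u y 2) x (EuclideanSpace.single 1 (1 : ℝ)) - fderiv ℝ u x (EuclideanSpace.single 2 (1 : ℝ)) 1)) -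
        2 * g (c 2 + z) * hmean φ c R z (fun x => u x 2)| ≤
      R⁻¹ * (M₀ * M₀ * M₀ + 4 * (M₀ * M₁)) * bumpK φ := by
  have hud : Differentiable ℝ u := hu.differentiable (by norm_num)
  have hθ2 : ContDiff ℝ 2 (fun y => u y 2) := contDiff_two_vert hu
  have hθd : Differentiable ℝ (fun y => u y 2) := hθ2.differentiable (by norm_num)
  have hc : ∀ i : Fin 3, ContDiff ℝ 2 (fun y => u y i) := fun i => contDiff_coord hu i
  have hc0 : ContDiff ℝ 1 (fun y => u y 0) := (hc 0).of_le (by norm_num)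
  have hc1 : ContDiff ℝ 1 (fun y => u y 1) := (hc 1).of_le (by norm_num)
  have hM₀0 : 0 ≤ M₀ := (norm_nonneg _).trans (hM₀ 0)
  have hM₁0 : 0 ≤ M₁ := (norm_nonneg _).trans (hM₁ 0)
  -- named pieces
  obtain ⟨Φ₀, hΦ₀⟩ : ∃ Φ₀ : EuclideanSpace ℝ (Fin 3) → ℝ, Φ₀ = fun y => u y 0 * u y 2 ^ 2 := ⟨_, rfl⟩
  obtain ⟨Φ₁, hΦ₁⟩ : ∃ Φ₁ : EuclideanSpace ℝ (Fin 3) → ℝ, Φ₁ = fun y => u y 1 * u y 2 ^ 2 := ⟨_, rfl⟩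
  obtain ⟨Ψ₀, hΨ₀⟩ : ∃ Ψ₀ : EuclideanSpace ℝ (Fin 3) → ℝ,
      Ψ₀ = fun y => fderiv ℝ (fun y' => u y' 2) y (EuclideanSpace.single 0 (1 : ℝ)) := ⟨_, rfl⟩
  obtain ⟨Ψ₁, hΨ₁⟩ : ∃ Ψ₁ : EuclideanSpace ℝ (Fin 3) → ℝ,
      Ψ₁ = fun y => fderiv ℝ (fun y' => u y' 2) y (EuclideanSpace.single 1 (1 : ℝ)) := ⟨_, rfl⟩
  obtain ⟨S₀, hS₀⟩ : ∃ S₀ : EuclideanSpace ℝ (Fin 3) → ℝ, S₀ = fun y => fderiv ℝ u y (EuclideanSpace.single 2 (1 : ℝ)) 0 := ⟨_, rfl⟩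
  obtain ⟨S₁, hS₁⟩ : ∃ S₁ : EuclideanSpace ℝ (Fin 3) → ℝ, S₁ = fun y => fderiv ℝ u y (EuclideanSpace.single 2 (1 : ℝ)) 1 := ⟨_, rfl⟩
  obtain ⟨Ω₀, hΩ₀⟩ : ∃ Ω₀ : EuclideanSpace ℝ (Fin 3) → ℝ, Ω₀ = fun y => u y 2 * (Ψ₀ y - S₀ y) := ⟨_, rfl⟩
  obtain ⟨Ω₁, hΩ₁⟩ : ∃ Ω₁ : EuclideanSpace ℝ (Fin 3) → ℝ, Ω₁ = fun y => u y 2 * (Ψ₁ y - S₁ y) := ⟨_, rfl⟩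
  obtain ⟨A, hA⟩ : ∃ A : EuclideanSpace ℝ (Fin 3) → ℝ, A = fun x =>
      fderiv ℝ Φ₀ x (EuclideanSpace.single 0 (1 : ℝ)) + fderiv ℝ Φ₁ x (EuclideanSpace.single 1 (1 : ℝ)) := ⟨_, rfl⟩
  obtain ⟨B, hB⟩ : ∃ B : EuclideanSpace ℝ (Fin 3) → ℝ, B = fun x =>
      fderiv ℝ (fun y => u y 2 ^ 3) x (EuclideanSpace.single 2 (1 : ℝ)) := ⟨_, rfl⟩
  obtain ⟨Cc, hCc⟩ : ∃ Cc : EuclideanSpace ℝ (Fin 3) → ℝ, Cc = fun x =>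
      fderiv ℝ Ω₀ x (EuclideanSpace.single 0 (1 : ℝ)) + fderiv ℝ Ω₁ x (EuclideanSpace.single 1 (1 : ℝ)) := ⟨_, rfl⟩
  obtain ⟨Q, hQ⟩ : ∃ Q : EuclideanSpace ℝ (Fin 3) → ℝ, Q = fun x =>
      fderiv ℝ (fun y => u y 2) x (EuclideanSpace.single 0 (1 : ℝ)) *
        (fderiv ℝ (fun y => u y 2) x (EuclideanSpace.single 0 (1 : ℝ)) - fderiv ℝ u x (EuclideanSpace.single 2 (1 : ℝ)) 0) +
      fderiv ℝ (fun y => u y 2) x (EuclideanSpace.single 1 (1 : ℝ)) *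
        (fderiv ℝ (fun y => u y 2) x (EuclideanSpace.single 1 (1 : ℝ)) - fderiv ℝ u x (EuclideanSpace.single 2 (1 : ℝ)) 1) := ⟨_, rfl⟩
  obtain ⟨P, hP⟩ : ∃ P : EuclideanSpace ℝ (Fin 3) → ℝ, P = fun x => 2 * u x 2 * θt x := ⟨_, rfl⟩
  have hΨ₀c : ContDiff ℝ 1 Ψ₀ := by rw [hΨ₀]; exact contDiff_one_fderiv_vert hu _
  have hΨ₁c : ContDiff ℝ 1 Ψ₁ := by rw [hΨ₁]; exact contDiff_one_fderiv_vert hu _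
  have hS₀c : ContDiff ℝ 1 S₀ := by rw [hS₀]; exact contDiff_one_fderiv_apply hu _ 0
  have hS₁c : ContDiff ℝ 1 S₁ := by rw [hS₁]; exact contDiff_one_fderiv_apply hu _ 1
  have hΦ₀c : ContDiff ℝ 1 Φ₀ := by rw [hΦ₀]; exact hc0.mul ((hθ2.of_le (by norm_num)).pow 2)
  have hΦ₁c : ContDiff ℝ 1 Φ₁ := by rw [hΦ₁]; exact hc1.mul ((hθ2.of_le (by norm_num)).pow 2)
  have hΩ₀c : ContDiff ℝ 1 Ω₀ := by rw [hΩ₀]; exact (hθ2.of_le (by norm_num)).mul (hΨ₀c.sub hS₀c)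
  have hΩ₁c : ContDiff ℝ 1 Ω₁ := by rw [hΩ₁]; exact (hθ2.of_le (by norm_num)).mul (hΨ₁c.sub hS₁c)
  have hΨ₀b : ∀ x, |Ψ₀ x| ≤ M₁ := fun x => by
    rw [hΨ₀]; dsimp only; rw [fderiv_coord_apply (hud x) 2]; exact abs_fderiv_single_le hM₁ x 0 2
  have hΨ₁b : ∀ x, |Ψ₁ x| ≤ M₁ := fun x => by
    rw [hΨ₁]; dsimp only; rw [fderiv_coord_apply (hud x) 2]; exact abs_fderiv_single_le hM₁ x 1 2
  have hS₀b : ∀ x, |S₀ x| ≤ M₁ := fun x => by rw [hS₀]; exact abs_fderiv_single_le hM₁ x 2 0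
  have hS₁b : ∀ x, |S₁ x| ≤ M₁ := fun x => by rw [hS₁]; exact abs_fderiv_single_le hM₁ x 2 1
  have hsqb : ∀ x, |u x 2 ^ 2| ≤ M₀ * M₀ := fun x => by
    rw [abs_pow, pow_two]; exact mul_le_mul (abs_coord_le hM₀ x 2) (abs_coord_le hM₀ x 2) (abs_nonneg _) hM₀0
  have hΦ₀b : ∀ x, |Φ₀ x| ≤ M₀ * M₀ * M₀ := fun x => by
    rw [hΦ₀]; dsimp only; rw [abs_mul]
    calc _ ≤ M₀ * (M₀ * M₀) := mul_le_mul (abs_coord_le hM₀ x 0) (hsqb x) (abs_nonneg _) hM₀0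
      _ = _ := by ring
  have hΦ₁b : ∀ x, |Φ₁ x| ≤ M₀ * M₀ * M₀ := fun x => by
    rw [hΦ₁]; dsimp only; rw [abs_mul]
    calc _ ≤ M₀ * (M₀ * M₀) := mul_le_mul (abs_coord_le hM₀ x 1) (hsqb x) (abs_nonneg _) hM₀0
      _ = _ := by ring
  have hΩ₀b : ∀ x, |Ω₀ x| ≤ M₀ * (2 * M₁) := fun x => by
    rw [hΩ₀]; dsimp only; rw [abs_mul]
    exact mul_le_mul (abs_coord_le hM₀ x 2) ((abs_sub _ _).trans (by linarith [hΨ₀b x, hS₀b x])) (abs_nonneg _) hM₀0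
  have hΩ₁b : ∀ x, |Ω₁ x| ≤ M₀ * (2 * M₁) := fun x => by
    rw [hΩ₁]; dsimp only; rw [abs_mul]
    exact mul_le_mul (abs_coord_le hM₀ x 2) ((abs_sub _ _).trans (by linarith [hΨ₁b x, hS₁b x])) (abs_nonneg _) hM₀0
  -- `∂₂²θ = −(∂₀S₀ + ∂₁S₁)` from `div u = 0`
  have hdS : ∀ (b : Fin 3) x, DifferentiableAt ℝ (fun y => fderiv ℝ (fun y' => u y' b) y (EuclideanSpace.single b (1 : ℝ))) x :=
    fun b x => ((((hc b).fderiv_right (m := 1) (by norm_num)).clm_apply contDiff_const).differentiable one_ne_zero) x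
  have hL2 : ∀ x, fderiv ℝ (fun y => fderiv ℝ (fun y' => u y' 2) y (EuclideanSpace.single 2 (1 : ℝ))) x
      (EuclideanSpace.single 2 (1 : ℝ)) =
      -(fderiv ℝ S₀ x (EuclideanSpace.single 0 (1 : ℝ)) + fderiv ℝ S₁ x (EuclideanSpace.single 1 (1 : ℝ))) := by
    intro x
    have hF : (fun y => fderiv ℝ (fun y' => u y' 2) y (EuclideanSpace.single 2 (1 : ℝ))) = fun y =>
        -(fderiv ℝ (fun y' => u y' 0) y (EuclideanSpace.single 0 (1 : ℝ)) +
          fderiv ℝ (fun y' => u y' 1) y (EuclideanSpace.single 1 (1 : ℝ))) := by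
      funext y
      rw [fderiv_coord_apply (hud y) 2, fderiv_coord_apply (hud y) 0, fderiv_coord_apply (hud y) 1]
      linarith [hdiv y]
    rw [hF, fderiv_fun_neg, neg_apply, fderiv_fun_add (hdS 0 x) (hdS 1 x)]
    simp only [_root_.add_apply]
    rw [fderiv_fderiv_symm (hc 0), fderiv_fderiv_symm (hc 1)]
    have e0 : (fun y => fderiv ℝ (fun y' => u y' 0) y (EuclideanSpace.single 2 (1 : ℝ))) = S₀ := by
      rw [hS₀]; funext y; exact fderiv_coord_apply (hud y) 0 _
    have e1 : (fun y => fderiv ℝ (fun y' => u y' 1) y (EuclideanSpace.single 2 (1 : ℝ))) = S₁ := by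
      rw [hS₁]; funext y; exact fderiv_coord_apply (hud y) 1 _
    rw [e0, e1]
  -- the pointwise identity `2gθ = 2θθₜ + A + B − 2Cc + 2Q`
  have hpt : ∀ x, 2 * g (x 2) * u x 2 = P x + A x + B x - 2 * Cc x + 2 * Q x := by
    intro x
    have h := heq x
    simp only [Fin.sum_univ_three] at h
    rw [fderiv_apply_eq_sum] at h
    simp only [Fin.sum_univ_three] at h
    rw [← hΨ₀, ← hΨ₁, hL2 x] at h
    have hsqd : DifferentiableAt ℝ (fun y => u y 2 ^ 2) x := (hθd x).pow 2
    have p0 : fderiv ℝ Φ₀ x (EuclideanSpace.single 0 (1 : ℝ)) =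
        u x 0 * (2 * u x 2 * fderiv ℝ (fun y => u y 2) x (EuclideanSpace.single 0 (1 : ℝ))) +
          u x 2 ^ 2 * fderiv ℝ u x (EuclideanSpace.single 0 (1 : ℝ)) 0 := by
      rw [hΦ₀, fderiv_mul_apply (g₂ := fun y => u y 2 ^ 2) ((hc0.differentiable one_ne_zero) x) hsqd,
        fderiv_sq_apply (hθd x), fderiv_coord_apply (hud x) 0]
    have p1 : fderiv ℝ Φ₁ x (EuclideanSpace.single 1 (1 : ℝ)) =
        u x 1 * (2 * u x 2 * fderiv ℝ (fun y => u y 2) x (EuclideanSpace.single 1 (1 : ℝ))) +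
          u x 2 ^ 2 * fderiv ℝ u x (EuclideanSpace.single 1 (1 : ℝ)) 1 := by
      rw [hΦ₁, fderiv_mul_apply (g₂ := fun y => u y 2 ^ 2) ((hc1.differentiable one_ne_zero) x) hsqd,
        fderiv_sq_apply (hθd x), fderiv_coord_apply (hud x) 1]
    have p2 : B x = 3 * u x 2 ^ 2 * fderiv ℝ u x (EuclideanSpace.single 2 (1 : ℝ)) 2 := by
      rw [hB]; dsimp only; rw [fderiv_cube_apply (hθd x), fderiv_coord_apply (hud x) 2]
    have p3 : fderiv ℝ (fun y => u y 2) x (EuclideanSpace.single 2 (1 : ℝ)) =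
        fderiv ℝ u x (EuclideanSpace.single 2 (1 : ℝ)) 2 := fderiv_coord_apply (hud x) 2 _
    have hΨS0 : DifferentiableAt ℝ (fun y => Ψ₀ y - S₀ y) x :=
      ((hΨ₀c.differentiable one_ne_zero) x).sub ((hS₀c.differentiable one_ne_zero) x)
    have hΨS1 : DifferentiableAt ℝ (fun y => Ψ₁ y - S₁ y) x :=
      ((hΨ₁c.differentiable one_ne_zero) x).sub ((hS₁c.differentiable one_ne_zero) x)
    have q0 : fderiv ℝ Ω₀ x (EuclideanSpace.single 0 (1 : ℝ)) =
        u x 2 * (fderiv ℝ Ψ₀ x (EuclideanSpace.single 0 (1 : ℝ)) - fderiv ℝ S₀ x (EuclideanSpace.single 0 (1 : ℝ))) +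
          (Ψ₀ x - S₀ x) * fderiv ℝ (fun y => u y 2) x (EuclideanSpace.single 0 (1 : ℝ)) := by
      rw [hΩ₀, fderiv_mul_apply (g₂ := fun y => Ψ₀ y - S₀ y) (hθd x) hΨS0,
        fderiv_fun_sub ((hΨ₀c.differentiable one_ne_zero) x) ((hS₀c.differentiable one_ne_zero) x)]
      rfl
    have q1 : fderiv ℝ Ω₁ x (EuclideanSpace.single 1 (1 : ℝ)) =
        u x 2 * (fderiv ℝ Ψ₁ x (EuclideanSpace.single 1 (1 : ℝ)) - fderiv ℝ S₁ x (EuclideanSpace.single 1 (1 : ℝ))) +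
          (Ψ₁ x - S₁ x) * fderiv ℝ (fun y => u y 2) x (EuclideanSpace.single 1 (1 : ℝ)) := by
      rw [hΩ₁, fderiv_mul_apply (g₂ := fun y => Ψ₁ y - S₁ y) (hθd x) hΨS1,
        fderiv_fun_sub ((hΨ₁c.differentiable one_ne_zero) x) ((hS₁c.differentiable one_ne_zero) x)]
      rfl
    have r0 : Ψ₀ x = fderiv ℝ (fun y => u y 2) x (EuclideanSpace.single 0 (1 : ℝ)) := by rw [hΨ₀]
    have r1 : Ψ₁ x = fderiv ℝ (fun y => u y 2) x (EuclideanSpace.single 1 (1 : ℝ)) := by rw [hΨ₁]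
    have s0 : S₀ x = fderiv ℝ u x (EuclideanSpace.single 2 (1 : ℝ)) 0 := by rw [hS₀]
    have s1 : S₁ x = fderiv ℝ u x (EuclideanSpace.single 2 (1 : ℝ)) 1 := by rw [hS₁]
    have pA : A x = fderiv ℝ Φ₀ x (EuclideanSpace.single 0 (1 : ℝ)) + fderiv ℝ Φ₁ x (EuclideanSpace.single 1 (1 : ℝ)) := by
      rw [hA]
    have pC : Cc x = fderiv ℝ Ω₀ x (EuclideanSpace.single 0 (1 : ℝ)) + fderiv ℝ Ω₁ x (EuclideanSpace.single 1 (1 : ℝ)) := by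
      rw [hCc]
    have pQ : Q x = fderiv ℝ (fun y => u y 2) x (EuclideanSpace.single 0 (1 : ℝ)) *
        (fderiv ℝ (fun y => u y 2) x (EuclideanSpace.single 0 (1 : ℝ)) - fderiv ℝ u x (EuclideanSpace.single 2 (1 : ℝ)) 0) +
      fderiv ℝ (fun y => u y 2) x (EuclideanSpace.single 1 (1 : ℝ)) *
        (fderiv ℝ (fun y => u y 2) x (EuclideanSpace.single 1 (1 : ℝ)) - fderiv ℝ u x (EuclideanSpace.single 2 (1 : ℝ)) 1) := by
      rw [hQ]
    have pP : P x = 2 * u x 2 * θt x := by rw [hP]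
    rw [p3] at h
    linear_combination (-(2 * u x 2)) * h - pP - pA - p0 - p1 - p2 - u x 2 ^ 2 * hdiv x +
      2 * (pC + q0 + q1 - pQ) +
      2 * fderiv ℝ (fun y => u y 2) x (EuclideanSpace.single 0 (1 : ℝ)) * (r0 - s0) +
      2 * fderiv ℝ (fun y => u y 2) x (EuclideanSpace.single 1 (1 : ℝ)) * (r1 - s1)
  -- average it
  have hcP : Continuous P := by rw [hP]; exact (continuous_const.mul (contDiff_coord hu 2).continuous).mul hθt
  have hcA : Continuous A := by
    rw [hA]
    exact ((hΦ₀c.continuous_fderiv one_ne_zero).clm_apply continuous_const).add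
      ((hΦ₁c.continuous_fderiv one_ne_zero).clm_apply continuous_const)
  have hcB : Continuous B := by
    rw [hB]; exact ((hθ2.pow 3).continuous_fderiv (by norm_num)).clm_apply continuous_const
  have hcC : Continuous Cc := by
    rw [hCc]
    exact ((hΩ₀c.continuous_fderiv one_ne_zero).clm_apply continuous_const).add
      ((hΩ₁c.continuous_fderiv one_ne_zero).clm_apply continuous_const)
  have hθ' : Continuous fun x => fderiv ℝ (fun y => u y 2) x (EuclideanSpace.single 0 (1 : ℝ)) :=
    (hθ2.continuous_fderiv (by norm_num)).clm_apply continuous_const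
  have hθ'' : Continuous fun x => fderiv ℝ (fun y => u y 2) x (EuclideanSpace.single 1 (1 : ℝ)) :=
    (hθ2.continuous_fderiv (by norm_num)).clm_apply continuous_const
  have hcQ : Continuous Q := by
    rw [hQ]
    exact (hθ'.mul (hθ'.sub (hS₀c.continuous.congr fun x => by rw [hS₀]))).add
      (hθ''.mul (hθ''.sub (hS₁c.continuous.congr fun x => by rw [hS₁])))
  have hcC' : Continuous fun x => 2 * Cc x := continuous_const.mul hcC
  have hcQ' : Continuous fun x => 2 * Q x := continuous_const.mul hcQ
  have hmean_g : hmean φ c R z (fun x => P x + A x + B x - 2 * Cc x + 2 * Q x) =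
      2 * g (c 2 + z) * hmean φ c R z (fun x => u x 2) := by
    rw [← hmean_const_mul]
    unfold hmean
    congr 1
    funext y
    beta_reduce
    rw [← hpt, pt_apply_two]
  rw [hmean_add φ c R z (F := fun x => P x + A x + B x - 2 * Cc x) (G := fun x => 2 * Q x)
      (((hcP.add hcA).add hcB).sub hcC') hcQ',
    hmean_sub φ c R z (F := fun x => P x + A x + B x) (G := fun x => 2 * Cc x) ((hcP.add hcA).add hcB) hcC',
    hmean_add φ c R z (F := fun x => P x + A x) (G := B) (hcP.add hcA) hcB,
    hmean_add φ c R z (F := P) (G := A) hcP hcA, hmean_const_mul, hmean_const_mul] at hmean_g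
  have eA : |hmean φ c R z A| ≤ R⁻¹ * (M₀ * M₀ * M₀) * bumpK φ := by
    rw [hA]; exact abs_hmean_hdiv_le φ c z hR hΦ₀c hΦ₁c hΦ₀b hΦ₁b
  have eC : |hmean φ c R z Cc| ≤ R⁻¹ * (M₀ * (2 * M₁)) * bumpK φ := by
    rw [hCc]; exact abs_hmean_hdiv_le φ c z hR hΩ₀c hΩ₁c hΩ₀b hΩ₁b
  rw [← hP, ← hB, ← hQ]
  calc _ = |-hmean φ c R z A + 2 * hmean φ c R z Cc| := by
        congr 1; linear_combination hmean_g
    _ ≤ |hmean φ c R z A| + 2 * |hmean φ c R z Cc| := by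
        rw [← abs_neg (hmean φ c R z A)]
        refine (abs_add_le _ _).trans ?_
        rw [abs_mul, abs_two]
    _ ≤ R⁻¹ * (M₀ * M₀ * M₀) * bumpK φ + 2 * (R⁻¹ * (M₀ * (2 * M₁)) * bumpK φ) :=
        add_le_add eA (mul_le_mul_of_nonneg_left eC zero_le_two)
    _ = R⁻¹ * (M₀ * M₀ * M₀ + 4 * (M₀ * M₁)) * bumpK φ := by ring

/-- **KEY inequality on the separated-pressure stratum (one slice, averaged)**: inserting (b) into (c), the horizontal variance
`V = ⟨θ²⟩ − ⟨θ⟩²` and the flux `G = ½⟨θ³⟩ − ⟨θ⟩⟨θ²⟩ + ½⟨θ⟩³` satisfy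
`V̇ + 2G_z + 2⟨∇_hθ·(∇_hθ − ∂₂u_h)⟩ ≤ (8M₀³ + 8M₀M₁)K/R`, where `V̇ := ⟨2θθₜ⟩ − 2⟨θ⟩⟨θₜ⟩` and
`G_z := ½⟨∂₂θ³⟩ − ⟨∂₂θ⟩⟨θ²⟩ − ⟨θ⟩⟨∂₂θ²⟩ + (3/2)⟨θ⟩²⟨∂₂θ⟩` are the values of `∂ₜV`, `∂_zG` (the companion file
identifies them with the actual derivatives). -/
theorem key_mean_sep (hu : ContDiff ℝ 2 u)
    (hdiv : ∀ x, fderiv ℝ u x (EuclideanSpace.single 0 (1 : ℝ)) 0 + fderiv ℝ u x (EuclideanSpace.single 1 (1 : ℝ)) 1 +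
      fderiv ℝ u x (EuclideanSpace.single 2 (1 : ℝ)) 2 = 0)
    (hM₀ : ∀ x, ‖u x‖ ≤ M₀) (hM₁ : ∀ x, ‖fderiv ℝ u x‖ ≤ M₁) (hθt : Continuous θt)
    (heq : ∀ x, θt x + fderiv ℝ (fun y => u y 2) x (u x) -
      ∑ i : Fin 3, fderiv ℝ (fun y => fderiv ℝ (fun y' => u y' 2) y (EuclideanSpace.single i (1 : ℝ))) x
        (EuclideanSpace.single i (1 : ℝ)) = g (x 2))
    (hR : 0 < R) :
    (hmean φ c R z (fun x => 2 * u x 2 * θt x) - 2 * hmean φ c R z (fun x => u x 2) * hmean φ c R z θt) +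
      2 * (hmean φ c R z (fun x => fderiv ℝ (fun y => u y 2 ^ 3) x (EuclideanSpace.single 2 (1 : ℝ))) / 2
        - hmean φ c R z (fun x => fderiv ℝ u x (EuclideanSpace.single 2 (1 : ℝ)) 2) *
            hmean φ c R z (fun x => u x 2 ^ 2)
        - hmean φ c R z (fun x => u x 2) *
            hmean φ c R z (fun x => fderiv ℝ (fun y => u y 2 ^ 2) x (EuclideanSpace.single 2 (1 : ℝ)))
        + 3 / 2 * hmean φ c R z (fun x => u x 2) ^ 2 *
            hmean φ c R z (fun x => fderiv ℝ u x (EuclideanSpace.single 2 (1 : ℝ)) 2)) +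
      2 * hmean φ c R z (fun x =>
          fderiv ℝ (fun y => u y 2) x (EuclideanSpace.single 0 (1 : ℝ)) *
            (fderiv ℝ (fun y => u y 2) x (EuclideanSpace.single 0 (1 : ℝ)) - fderiv ℝ u x (EuclideanSpace.single 2 (1 : ℝ)) 0) +
          fderiv ℝ (fun y => u y 2) x (EuclideanSpace.single 1 (1 : ℝ)) *
            (fderiv ℝ (fun y => u y 2) x (EuclideanSpace.single 1 (1 : ℝ)) - fderiv ℝ u x (EuclideanSpace.single 2 (1 : ℝ)) 1)) ≤
      R⁻¹ * (8 * (M₀ * M₀ * M₀) + 8 * (M₀ * M₁)) * bumpK φ := by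
  have hθc : Continuous (fun y => u y 2) := (contDiff_coord hu 2).continuous
  have hM₀0 : 0 ≤ M₀ := (norm_nonneg _).trans (hM₀ 0)
  have hM₁0 : 0 ≤ M₁ := (norm_nonneg _).trans (hM₁ 0)
  have hK0 : 0 ≤ bumpK φ := bumpK_nonneg φ
  have hR0 : 0 ≤ R⁻¹ := inv_nonneg.2 hR.le
  -- abbreviations
  set m := hmean φ c R z (fun x => u x 2) with hm
  set mt := hmean φ c R z θt with hmt
  set E := hmean φ c R z (fun x => u x 2 ^ 2) with hE
  set Ez := hmean φ c R z (fun x => fderiv ℝ (fun y => u y 2 ^ 2) x (EuclideanSpace.single 2 (1 : ℝ))) with hEz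
  set mz := hmean φ c R z (fun x => fderiv ℝ u x (EuclideanSpace.single 2 (1 : ℝ)) 2) with hmz
  set mzz := hmean φ c R z (fun x => fderiv ℝ (fun y => fderiv ℝ u y (EuclideanSpace.single 2 (1 : ℝ)) 2) x
    (EuclideanSpace.single 2 (1 : ℝ))) with hmzz
  set Tz := hmean φ c R z (fun x => fderiv ℝ (fun y => u y 2 ^ 3) x (EuclideanSpace.single 2 (1 : ℝ))) with hTz
  set Et := hmean φ c R z (fun x => 2 * u x 2 * θt x) with hEt
  set D := hmean φ c R z (fun x =>
          fderiv ℝ (fun y => u y 2) x (EuclideanSpace.single 0 (1 : ℝ)) *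
            (fderiv ℝ (fun y => u y 2) x (EuclideanSpace.single 0 (1 : ℝ)) - fderiv ℝ u x (EuclideanSpace.single 2 (1 : ℝ)) 0) +
          fderiv ℝ (fun y => u y 2) x (EuclideanSpace.single 1 (1 : ℝ)) *
            (fderiv ℝ (fun y => u y 2) x (EuclideanSpace.single 1 (1 : ℝ)) - fderiv ℝ u x (EuclideanSpace.single 2 (1 : ℝ)) 1)) with hD
  -- the two identities and the four small means
  have hmzz' : mzz = hmean φ c R z (fun x => fderiv ℝ (fun y => fderiv ℝ (fun y' => u y' 2) y
      (EuclideanSpace.single 2 (1 : ℝ))) x (EuclideanSpace.single 2 (1 : ℝ))) := by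
    have hud : Differentiable ℝ u := hu.differentiable (by norm_num)
    have hfun : (fun y => fderiv ℝ u y (EuclideanSpace.single 2 (1 : ℝ)) 2) =
        fun y => fderiv ℝ (fun y' => u y' 2) y (EuclideanSpace.single 2 (1 : ℝ)) :=
      funext fun y => (fderiv_coord_apply (hud y) 2 _).symm
    rw [hmzz, hfun]
  have hb := residual_mean φ c z hu hdiv hM₀ hM₁ hθt heq hR
  rw [← hmt, ← hEz, ← hmzz'] at hb
  have hc' := energy_mean_sep φ c z hu hdiv hM₀ hM₁ hθt heq hR
  rw [← hEt, ← hTz, ← hD, ← hm] at hc'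
  have hz := abs_hmean_dz_le φ c z hu hdiv hM₀ hR
  rw [← hmz] at hz
  have hzz := abs_hmean_dzz_le φ c z hu hdiv hM₁ hR
  rw [← hmzz] at hzz
  have hmb : |m| ≤ M₀ := abs_hmean_le φ c R z hθc fun x => abs_coord_le hM₀ x 2
  have hEb : |E| ≤ M₀ * M₀ := abs_hmean_le φ c R z (F := fun x => u x 2 ^ 2) (hθc.pow 2) fun x => by
    rw [abs_pow, pow_two]; exact mul_le_mul (abs_coord_le hM₀ x 2) (abs_coord_le hM₀ x 2) (abs_nonneg _) hM₀0
  -- algebra: LHS = ρc + 2mρb − 2m·mzz − 2mz·E + 3m²·mz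
  set ρb := g (c 2 + z) - (mt + Ez - mzz) with hρb
  set ρc := Et + Tz + 2 * D - 2 * g (c 2 + z) * m with hρc
  have hid : (Et - 2 * m * mt) + 2 * (Tz / 2 - mz * E - m * Ez + 3 / 2 * m ^ 2 * mz) + 2 * D =
      ρc + 2 * m * ρb - 2 * m * mzz - 2 * mz * E + 3 * m ^ 2 * mz := by
    rw [hρb, hρc]; ring
  rw [hid]
  calc ρc + 2 * m * ρb - 2 * m * mzz - 2 * mz * E + 3 * m ^ 2 * mz
      ≤ |ρc| + 2 * |m| * |ρb| + 2 * |m| * |mzz| + 2 * |mz| * |E| + 3 * |m| ^ 2 * |mz| := by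
        have e1 : ρc ≤ |ρc| := le_abs_self _
        have e2 : 2 * m * ρb ≤ 2 * |m| * |ρb| := by
          rw [mul_assoc, mul_assoc, ← abs_mul]; exact mul_le_mul_of_nonneg_left (le_abs_self _) zero_le_two
        have e3 : -(2 * m * mzz) ≤ 2 * |m| * |mzz| := by
          rw [mul_assoc, mul_assoc, ← abs_mul, ← mul_neg]; exact mul_le_mul_of_nonneg_left (neg_le_abs _) zero_le_two
        have e4 : -(2 * mz * E) ≤ 2 * |mz| * |E| := by
          rw [mul_assoc, mul_assoc, ← abs_mul, ← mul_neg]; exact mul_le_mul_of_nonneg_left (neg_le_abs _) zero_le_two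
        have e5 : 3 * m ^ 2 * mz ≤ 3 * |m| ^ 2 * |mz| := by
          rw [← sq_abs m, mul_assoc, mul_assoc]
          exact mul_le_mul_of_nonneg_left (mul_le_mul_of_nonneg_left (le_abs_self _) (sq_nonneg _)) (by norm_num)
        linarith
    _ ≤ R⁻¹ * (M₀ * M₀ * M₀ + 4 * (M₀ * M₁)) * bumpK φ +
          2 * M₀ * (R⁻¹ * (M₀ * M₀ + M₁) * bumpK φ) + 2 * M₀ * (R⁻¹ * M₁ * bumpK φ) +
          2 * (R⁻¹ * M₀ * bumpK φ) * (M₀ * M₀) + 3 * M₀ ^ 2 * (R⁻¹ * M₀ * bumpK φ) := by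
        gcongr
    _ = R⁻¹ * (8 * (M₀ * M₀ * M₀) + 8 * (M₀ * M₁)) * bumpK φ := by ring

end Slice

end Summit.NavierStokesRegularity.NavierStokesRegularity.Theorems.PoloidalWindowDoorPoloidalWindowRigiditySeparatedShearEnergy

end
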